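import Literature.AlgebraicGeometry.ProjectiveSpace.WellCoveredBipartiteGraphs
import Mathlib.Combinatorics.SimpleGraph.CycleGraph
import HarnessLib

/-!
# Well-covered graphs with a basic clique cover (Zaare-Nahandi 2015, §2: the class `𝒢`,
# Proposition 2.1 and Theorem 2.2)

Topic `Literature/AlgebraicGeometry/ProjectiveSpace`, namespace
`Literature.AlgebraicGeometry.ProjectiveSpace`. Lane `lit-hodgefound`, seat `lit-hodgefound-p32`,
row gen31-#4. Theorems only (no `def`, no named fact). Continues `WellCoveredBipartiteGraphs`
(gen31-#2: Ravindra's criterion is the case of the clique cover by the edges of a perfect matching).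

## The source, as printed

R. Zaare-Nahandi, *Pure simplicial complexes and well-covered graphs*, §2. "Let `𝒢` be the class of
graphs such that for each `G ∈ 𝒢` there are `k = α(G)` cliques in `G` covering all its vertices. …
Then, `Q'_1, …, Q'_k` are `k` disjoint cliques covering all vertices of `G`. We call such a set of
cliques, a basic clique cover of the graph `G`. … Note that, `k = α(G)` is the smallest number which
the graph `G` may has a clique cover. It is not true that any graph has a basic clique cover. For
example, a cycle of length `4` has a basic clique cover consisting of `2` cliques but a cycle of
length `5` does not have any basic clique cover." **Proposition 2.1.** "Let `Δ` be a simplicial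
complex. Then, `G(Δ)` is in the class `𝒢`. …" Proof: "any two faces in `Δ` with the same dimension
are not comparable. Therefore … the corresponding vertices in the graph `G(Δ)` make a clique."
**Theorem 2.2.** "Let `G` be a graph in the class `𝒢` with a basic clique cover `Q_1, …, Q_k`. Then
`G` is well-covered if and only if for each `i`, `1 ≤ i ≤ k`, if `A ⊆ V(G) ∖ Q_i` dominates `Q_i`,
then `A` is not an independent set." (§1: "We say `A` dominates `B` if for any vertex `v` in `B`, `v`
is in `A` or there is at least one vertex in `A` adjacent to `v`.")

## Dictionary and what is here

`G` is a Mathlib `SimpleGraph` on a finite vertex type `σ`. A clique cover by disjoint cliques is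
recorded as a CLASS MAP `q : σ → ι` to a finite index type whose fibres are cliques
(`u ≠ v`, `q u = q v ⟹ u ∼ v`); the cover `{q⁻¹(i)}` has (at most) `|ι|` cliques, and it is *basic*
when `|ι| = α(G)`. "`A ⊆ V ∖ Q_i` dominates `Q_i`" reads `(∀ a ∈ A, q a ≠ i)` and
`∀ v, q v = i → ∃ a ∈ A, v ∼ a`. Well-covered = all maximal independent sets
(`Maximal (fun A => G.IsIndepSet ↑A)`) have the same cardinality (gen31-#1).

* § 1 an independent set meets each clique of the cover at most once, so **`α(G) ≤ |ι|`** ("`α(G)` is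
  the smallest number" of cliques in a clique cover).
* § 2 **Theorem 2.2, "if"**: if no independent set outside `Q_i` dominates `Q_i` (for every `i`), then
  every maximal independent set meets every `Q_i`, hence has exactly `|ι|` elements: `G` is
  well-covered and the cover is basic (`α(G) = |ι|`).
* § 3 **Theorem 2.2, "only if"**: for a basic cover (`α(G) = |ι|`) of a well-covered graph, an
  independent `A` outside `Q_i` dominating `Q_i` would extend to a maximal independent set missing
  `Q_i`, of cardinality `< |ι|`; the theorem as an `iff`.
* § 4 **Proposition 2.1 (first half)**: in the non-comparability graph `G(Δ)` of the nonempty faces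
  of a complex, faces of equal cardinality are pairwise adjacent (the cardinality classes form a
  clique cover).
* § 5 examples by `decide`: `C_4` has the basic clique cover `{x_0x_1, x_2x_3}` and satisfies the
  criterion; `C_5` (with `α = 2`) has no cover by two cliques.

## References

* [ZaareNahandi2015] R. Zaare-Nahandi, *Pure simplicial complexes and well-covered graphs*, Rocky
  Mountain J. Math. 45 (2015), §1 (domination), §2 (class `𝒢`, basic clique covers), Prop. 2.1,
  Thm. 2.2.
-/

noncomputable section

open Finset

namespace Literature.AlgebraicGeometry.ProjectiveSpace

variable {σ ι : Type*} [Fintype σ] [DecidableEq σ] [Fintype ι] [DecidableEq ι]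
variable {G : SimpleGraph σ} {q : σ → ι}

/-! ### § 1 Independent sets meet each clique of a clique cover at most once -/

omit [Fintype σ] [DecidableEq σ] [Fintype ι] [DecidableEq ι] in
/-- The class map of a clique cover is injective on every independent set.
[cite: ZaareNahandi2015, Thm. 2.2 (proof: "`B` has at most one element in common with each `Q_j`")] -/
theorem injOn_of_isIndepSet_of_cliqueCover (hq : ∀ u v, u ≠ v → q u = q v → G.Adj u v)
    {F : Finset σ} (hF : G.IsIndepSet ↑F) : Set.InjOn q ↑F := by
  intro a ha b hb hab
  by_contra hne
  exact hF ha hb hne (hq a b hne hab)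

omit [Fintype σ] [DecidableEq σ] [DecidableEq ι] in
/-- **An independent set has at most as many elements as a clique cover has cliques.**
[cite: ZaareNahandi2015, §2 ("`k = α(G)` is the smallest number which the graph `G` may has a clique
cover")] -/
theorem card_le_card_of_isIndepSet_of_cliqueCover (hq : ∀ u v, u ≠ v → q u = q v → G.Adj u v)
    {F : Finset σ} (hF : G.IsIndepSet ↑F) : F.card ≤ Fintype.card ι := by
  rw [← Finset.card_univ]
  exact Finset.card_le_card_of_injOn q (fun a _ => Finset.mem_coe.mpr (Finset.mem_univ _))
    (injOn_of_isIndepSet_of_cliqueCover hq hF)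

omit [DecidableEq σ] [DecidableEq ι] in
/-- **`α(G) ≤` the number of cliques of any clique cover.** [cite: ZaareNahandi2015, §2] -/
theorem indepNum_le_card_of_cliqueCover (hq : ∀ u v, u ≠ v → q u = q v → G.Adj u v) :
    G.indepNum ≤ Fintype.card ι := by
  obtain ⟨S, hS⟩ := G.maximumIndepSet_exists
  rw [← SimpleGraph.maximumIndepSet_card_eq_indepNum S hS]
  exact card_le_card_of_isIndepSet_of_cliqueCover hq hS.isIndepSet

/-! ### § 2 Theorem 2.2, "if": the domination criterion forces `|F| = |ι|` -/

omit [Fintype σ] [DecidableEq σ] in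
/-- **Theorem 2.2, "if" direction**: if, for every class `i`, no independent set outside `Q_i`
dominates `Q_i`, then every maximal independent set meets every class and has exactly `|ι|`
elements. [cite: ZaareNahandi2015, Thm. 2.2] -/
theorem card_eq_card_of_maximal_isIndepSet_of_cliqueCover
    (hq : ∀ u v, u ≠ v → q u = q v → G.Adj u v)
    (hdom : ∀ (i : ι) (A : Finset σ), (∀ a ∈ A, q a ≠ i) →
      (∀ v, q v = i → ∃ a ∈ A, G.Adj v a) → ¬ G.IsIndepSet ↑A)
    {F : Finset σ} (hF : Maximal (fun A : Finset σ => G.IsIndepSet ↑A) F) :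
    F.card = Fintype.card ι := by
  have hsurj : F.image q = univ := by
    rw [Finset.eq_univ_iff_forall]
    intro i
    by_contra hi
    have hFi : ∀ a ∈ F, q a ≠ i := fun a ha hqa => hi (Finset.mem_image.mpr ⟨a, ha, hqa⟩)
    have hnd : ¬ ∀ v, q v = i → ∃ a ∈ F, G.Adj v a := fun hd => hdom i F hFi hd hF.1
    push Not at hnd
    obtain ⟨v, hqv, hv⟩ := hnd
    have hvF : v ∉ F := fun hvF => hFi v hvF hqv
    obtain ⟨u, hu, hvu⟩ := exists_mem_adj_of_not_mem_of_maximal_isIndepSet G hF hvF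
    exact hv u hu hvu
  have h := Finset.card_image_of_injOn (injOn_of_isIndepSet_of_cliqueCover hq hF.1)
  rw [hsurj, Finset.card_univ] at h
  exact h.symm

omit [Fintype σ] [DecidableEq σ] in
/-- **Hence `G` is well-covered** under the domination criterion.
[cite: ZaareNahandi2015, Thm. 2.2] -/
theorem wellCovered_of_cliqueCover (hq : ∀ u v, u ≠ v → q u = q v → G.Adj u v)
    (hdom : ∀ (i : ι) (A : Finset σ), (∀ a ∈ A, q a ≠ i) →
      (∀ v, q v = i → ∃ a ∈ A, G.Adj v a) → ¬ G.IsIndepSet ↑A) :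
    ∀ F F' : Finset σ, Maximal (fun A : Finset σ => G.IsIndepSet ↑A) F →
      Maximal (fun A : Finset σ => G.IsIndepSet ↑A) F' → F.card = F'.card := by
  intro F F' hF hF'
  rw [card_eq_card_of_maximal_isIndepSet_of_cliqueCover hq hdom hF,
    card_eq_card_of_maximal_isIndepSet_of_cliqueCover hq hdom hF']

omit [DecidableEq σ] in
/-- … and the cover is basic: **`α(G) = |ι|`**. [cite: ZaareNahandi2015, Thm. 2.2] -/
theorem indepNum_eq_card_of_cliqueCover (hq : ∀ u v, u ≠ v → q u = q v → G.Adj u v)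
    (hdom : ∀ (i : ι) (A : Finset σ), (∀ a ∈ A, q a ≠ i) →
      (∀ v, q v = i → ∃ a ∈ A, G.Adj v a) → ¬ G.IsIndepSet ↑A) :
    G.indepNum = Fintype.card ι := by
  obtain ⟨S, hS⟩ := G.maximumIndepSet_exists
  rw [← SimpleGraph.maximumIndepSet_card_eq_indepNum S hS]
  exact card_eq_card_of_maximal_isIndepSet_of_cliqueCover hq hdom
    (maximal_isIndepSet_of_isMaximumIndepSet G hS)

/-! ### § 3 Theorem 2.2, "only if", and the criterion as printed -/

omit [DecidableEq σ] in
/-- **Theorem 2.2, "only if" direction**: for a basic clique cover (`α(G) = |ι|`) of a well-covered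
graph, an independent set never dominates a class `Q_i` ("there is a maximal independent set
`B` containing `A`. But, `B ∩ Q_i = ∅` … `|B| < k`"; the printed proviso `A ⊆ V ∖ Q_i` is not used).
[cite: ZaareNahandi2015, Thm. 2.2] -/
theorem not_isIndepSet_of_dominates_of_wellCovered (hq : ∀ u v, u ≠ v → q u = q v → G.Adj u v)
    (hbasic : G.indepNum = Fintype.card ι)
    (hwc : ∀ F F' : Finset σ, Maximal (fun A : Finset σ => G.IsIndepSet ↑A) F →
      Maximal (fun A : Finset σ => G.IsIndepSet ↑A) F' → F.card = F'.card)
    (i : ι) {A : Finset σ} (hdomA : ∀ v, q v = i → ∃ a ∈ A, G.Adj v a) :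
    ¬ G.IsIndepSet ↑A := by
  intro hA
  obtain ⟨B, hAB, hB⟩ := exists_maximal_isIndepSet_superset G hA
  have hcard : B.card = Fintype.card ι := by
    rw [(wellCovered_iff_forall_card_eq_indepNum G).mp hwc B hB, hbasic]
  have hBi : ∀ b ∈ B, q b ≠ i := by
    intro b hb hqb
    obtain ⟨a, ha, hba⟩ := hdomA b hqb
    exact hB.1 (Finset.mem_coe.mpr hb) (Finset.mem_coe.mpr (hAB ha)) (G.ne_of_adj hba) hba
  have hle : B.card ≤ (univ.erase i).card :=
    Finset.card_le_card_of_injOn q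
      (fun b hb => Finset.mem_coe.mpr (Finset.mem_erase.mpr ⟨hBi b (Finset.mem_coe.mp hb),
        Finset.mem_univ _⟩))
      (injOn_of_isIndepSet_of_cliqueCover hq hB.1)
  rw [Finset.card_erase_of_mem (Finset.mem_univ i), Finset.card_univ] at hle
  have hpos : 0 < Fintype.card ι := Fintype.card_pos_iff.mpr ⟨i⟩
  omega

omit [DecidableEq σ] in
/-- **Theorem 2.2.** For a graph with a basic clique cover `q` (`α(G) = |ι|` disjoint cliques
covering the vertices): `G` is well-covered iff for every `i`, every `A ⊆ V ∖ Q_i` dominating `Q_i`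
is dependent. [cite: ZaareNahandi2015, Thm. 2.2] -/
theorem wellCovered_iff_of_basicCliqueCover (hq : ∀ u v, u ≠ v → q u = q v → G.Adj u v)
    (hbasic : G.indepNum = Fintype.card ι) :
    (∀ F F' : Finset σ, Maximal (fun A : Finset σ => G.IsIndepSet ↑A) F →
        Maximal (fun A : Finset σ => G.IsIndepSet ↑A) F' → F.card = F'.card) ↔
      ∀ (i : ι) (A : Finset σ), (∀ a ∈ A, q a ≠ i) →
        (∀ v, q v = i → ∃ a ∈ A, G.Adj v a) → ¬ G.IsIndepSet ↑A :=
  ⟨fun hwc i _ _ hdomA => not_isIndepSet_of_dominates_of_wellCovered hq hbasic hwc i hdomA,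
    fun hdom => wellCovered_of_cliqueCover hq hdom⟩

omit [Fintype σ] [DecidableEq σ] in
/-- Under the criterion every maximal independent set is a transversal of the clique cover: it meets
each `Q_i` in exactly one vertex. [cite: ZaareNahandi2015, Thm. 2.2 (proof: "`|A ∩ Q_i| = 1`")] -/
theorem card_filter_eq_one_of_maximal_isIndepSet_of_cliqueCover
    (hq : ∀ u v, u ≠ v → q u = q v → G.Adj u v)
    (hdom : ∀ (i : ι) (A : Finset σ), (∀ a ∈ A, q a ≠ i) →
      (∀ v, q v = i → ∃ a ∈ A, G.Adj v a) → ¬ G.IsIndepSet ↑A)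
    {F : Finset σ} (hF : Maximal (fun A : Finset σ => G.IsIndepSet ↑A) F) (i : ι) :
    (F.filter (fun a => q a = i)).card = 1 := by
  -- at most one (injectivity) and at least one (the class is hit, by the cardinality count)
  have hle : (F.filter (fun a => q a = i)).card ≤ 1 := by
    rw [Finset.card_le_one]
    intro a ha b hb
    rw [Finset.mem_filter] at ha hb
    exact injOn_of_isIndepSet_of_cliqueCover hq hF.1 (Finset.mem_coe.mpr ha.1)
      (Finset.mem_coe.mpr hb.1) (ha.2.trans hb.2.symm)
  have hsum : ∑ j, (F.filter (fun a => q a = j)).card = F.card := by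
    rw [← Finset.card_eq_sum_card_fiberwise (f := q) (t := univ) fun a _ => Finset.mem_univ _]
  have hall : ∀ j, (F.filter (fun a => q a = j)).card ≤ 1 := by
    intro j
    rw [Finset.card_le_one]
    intro a ha b hb
    rw [Finset.mem_filter] at ha hb
    exact injOn_of_isIndepSet_of_cliqueCover hq hF.1 (Finset.mem_coe.mpr ha.1)
      (Finset.mem_coe.mpr hb.1) (ha.2.trans hb.2.symm)
  have hcard := card_eq_card_of_maximal_isIndepSet_of_cliqueCover hq hdom hF
  -- if the `i`-th fibre were empty the sum would be at most `|ι| - 1`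
  by_contra hne
  have h0 : (F.filter (fun a => q a = i)).card = 0 := by omega
  have hlt : ∑ j, (F.filter (fun a => q a = j)).card ≤ ∑ j ∈ univ.erase i, 1 := by
    rw [← Finset.sum_erase_add _ _ (Finset.mem_univ i), h0, add_zero]
    exact Finset.sum_le_sum fun j _ => hall j
  rw [Finset.sum_const, smul_eq_mul, mul_one, Finset.card_erase_of_mem (Finset.mem_univ i),
    Finset.card_univ, hsum, hcard] at hlt
  have hpos : 0 < Fintype.card ι := Fintype.card_pos_iff.mpr ⟨i⟩
  omega

/-! ### § 4 Proposition 2.1 (first half): the cardinality classes of `G(Δ)` are cliques -/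

/-- **"Any two faces in `Δ` with the same dimension are not comparable … the corresponding vertices in
the graph `G(Δ)` make a clique"**: in the non-comparability graph of the nonempty faces of `Δ`,
distinct faces of equal cardinality are adjacent — the cardinality map is a clique cover of `G(Δ)`.
[cite: ZaareNahandi2015, Prop. 2.1] -/
theorem noncomparabilityGraph_adj_of_card_eq {V : Type*} [DecidableEq V] (Δ : Finset (Finset V))
    (a b : {A : Finset V // A.Nonempty ∧ A ∈ Δ.biUnion powerset}) (hne : a ≠ b)
    (hcard : a.1.card = b.1.card) :
    (SimpleGraph.fromRel (fun a b : {A : Finset V // A.Nonempty ∧ A ∈ Δ.biUnion powerset} =>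
      ¬ a ≤ b ∧ ¬ b ≤ a)).Adj a b := by
  rw [SimpleGraph.fromRel_adj]
  refine ⟨hne, Or.inl ⟨fun h => hne ?_, fun h => hne ?_⟩⟩
  · exact Subtype.ext (Finset.eq_of_subset_of_card_le h hcard.ge)
  · exact Subtype.ext (Finset.eq_of_subset_of_card_le h hcard.le).symm

/-- The cardinality map of `G(Δ)` as a class map to `Fin (|V| + 1)`: its fibres are cliques.
[cite: ZaareNahandi2015, Prop. 2.1] -/
theorem noncomparabilityGraph_cliqueCover_card {V : Type*} [Fintype V] [DecidableEq V]
    (Δ : Finset (Finset V)) :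
    ∀ a b : {A : Finset V // A.Nonempty ∧ A ∈ Δ.biUnion powerset}, a ≠ b →
      (⟨a.1.card, Nat.lt_succ_of_le (Finset.card_le_univ a.1)⟩ : Fin (Fintype.card V + 1)) =
        ⟨b.1.card, Nat.lt_succ_of_le (Finset.card_le_univ b.1)⟩ →
      (SimpleGraph.fromRel (fun a b : {A : Finset V // A.Nonempty ∧ A ∈ Δ.biUnion powerset} =>
        ¬ a ≤ b ∧ ¬ b ≤ a)).Adj a b :=
  fun a b hne h => noncomparabilityGraph_adj_of_card_eq Δ a b hne (by
    have := congrArg Fin.val h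
    exact this)

/-! ### § 5 Examples: `C_4` and `C_5` -/

/-- **"A cycle of length `4` has a basic clique cover consisting of `2` cliques"**: the class map
`x_0, x_1 ↦ 0`, `x_2, x_3 ↦ 1` has clique fibres `{x_0x_1}`, `{x_2x_3}` (and `α(C_4) = 2`), and the
domination criterion of Theorem 2.2 holds, so `C_4` is well-covered. [cite: ZaareNahandi2015, §2
and Thm. 2.2] (example) -/
example : (∀ u v : Fin 4, u ≠ v → (![0, 0, 1, 1] : Fin 4 → Fin 2) u = (![0, 0, 1, 1] : Fin 4 → Fin 2) v →
      (SimpleGraph.cycleGraph 4).Adj u v) ∧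
    ∀ (i : Fin 2) (A : Finset (Fin 4)), (∀ a ∈ A, (![0, 0, 1, 1] : Fin 4 → Fin 2) a ≠ i) →
      (∀ v, (![0, 0, 1, 1] : Fin 4 → Fin 2) v = i → ∃ a ∈ A, (SimpleGraph.cycleGraph 4).Adj v a) →
        ¬ (SimpleGraph.cycleGraph 4).IsIndepSet ↑A := by
  decide

/-- **"A cycle of length `5` does not have any basic clique cover"**: `α(C_5) = 2`
(`DeKlerkPasechnikThetaDual.indepNum_cycleGraph_five` in the tree) but no map `V(C_5) → {0, 1}` has
clique fibres (a clique of `C_5` has at most two vertices). [cite: ZaareNahandi2015, §2] (example) -/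
example : ¬ ∃ q : Fin 5 → Fin 2, ∀ u v : Fin 5, u ≠ v → q u = q v →
    (SimpleGraph.cycleGraph 5).Adj u v := by
  decide

end Literature.AlgebraicGeometry.ProjectiveSpace
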